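import Literature.AlgebraicGeometry.Resolution.NearPointTauOrigin
import Literature.AlgebraicGeometry.Resolution.NearPointsPointCentre
import HarnessLib

/-!
# `τ(x′) ≥ τ(x)` at the near point over a point centre with `τ(x) = 2` (CoP1, Lemma 4.3 (3))

Topic: `Literature/AlgebraicGeometry/Resolution`. [CoP1] = Cossart–Piltant, J. Algebra 320 (2008)
1051–1082, Lemma 4.3 (3), p. 8: "If `τ(x) = 2`, `Y = {x}` and `x′ ∈ q⁻¹(x)` is near `x`, then
`x′` is uniquely determined, rational over `x` and has `τ(x′) ≥ τ(x) = 2`", with its proof (p. 9):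
"we choose `(y_1, y_2, y_3)` in such a way that `T_x = <Y_2, Y_3>`. By (11), the only point in
`q⁻¹(x)` which may be near `x` is the point `x′ := (y_1′ = y_1, y_2′ = y_2/y_1, y_3′ = y_3/y_1)`. If
`x′` is near `x`, … `F(Y_2′, Y_3′) ∈ cl_μ(J′) + (Y_1′)`. Therefore
`T_{x′} + k(x′) Y_1′ = <Y_1′, Y_2′, Y_3′>`. (12)"

PROVED here at scheme level (`IsBlowup.stalkTau_le_stalkTau_of_isNear_point`): for the blowing
up `π` of a locally Noetherian `X` along a centre `Y` with `𝓘_{Y,x} = 𝔪_x` at `x = π x′`,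
`𝒪_{X,x}` regular of dimension `3` and `𝒪_{X′,x′}` regular, if `τ(x) = 2` and `x′` is near then
`τ(x) ≤ τ(x′)`. The proof re-presents `x′` in the chart of the CHANGED regular system of parameters
`c̃_i = c_i − ã_i c_j` (`ã_i` lifting the coordinates `a_i` of the rational near point,
`NearPointsPointCentre.exists_map_eq_span_of_near_point`), in which `x′` is the ORIGIN
(`c̃_j` must generate `𝓘_Y 𝒪_{x′}`, and `c̃_i/c̃_j = c_i/c_j − ã_i ∈ 𝔪_{x′}`); there the initial
forms of `J` avoid `Y_j` (`PlaneNearForms.directrix_le_dualVanishingAt` and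
`subset_linearFormsSubalgebra_directrix`), and `NearPointTauOrigin.hironakaTauAt_le_hironakaTauAt_origin`
((12)) applies.

## Sources

* V. Cossart, O. Piltant, J. Algebra 320 (2008) 1051–1082, Lemma 4.3 (3) and its proof, (12),
  pp. 8–9. [CossartPiltant2008]
-/

noncomputable section

open CategoryTheory CategoryTheory.Limits AlgebraicGeometry TopologicalSpace IsLocalRing MvPolynomial

namespace Literature.AlgebraicGeometry.Resolution

universe u

open Scheme.IdealSheafData

/-! ## Ring level: the changed regular system of parameters -/

section Shift

variable {R : Type u} [CommRing R] {d : ℕ}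

/-- **The shifted regular system of parameters** `c̃_j = c_j`, `c̃_i = c_i − ã_i c_j` (`i ≠ j`).
[cite: CossartPiltant2008, proof of Lemma 4.3 (3)] -/
def shiftRsop (c : Fin d → R) (j : Fin d) (a : {i : Fin d // i ≠ j} → R) : Fin d → R := fun i =>
  if h : i = j then c j else c i - a ⟨i, h⟩ * c j

/-- `c̃_j = c_j`. [folklore] -/
theorem shiftRsop_self (c : Fin d → R) (j : Fin d) (a : {i : Fin d // i ≠ j} → R) :
    shiftRsop c j a j = c j := dif_pos rfl

/-- `c̃_i = c_i − ã_i c_j` for `i ≠ j`. [folklore] -/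
theorem shiftRsop_of_ne (c : Fin d → R) (j : Fin d) (a : {i : Fin d // i ≠ j} → R) {i : Fin d}
    (h : i ≠ j) : shiftRsop c j a i = c i - a ⟨i, h⟩ * c j := dif_neg h

/-- The shifted system generates the same ideal. [folklore] -/
theorem span_range_shiftRsop (c : Fin d → R) (j : Fin d) (a : {i : Fin d // i ≠ j} → R) :
    Ideal.span (Set.range (shiftRsop c j a)) = Ideal.span (Set.range c) := by
  apply le_antisymm
  · rw [Ideal.span_le]
    rintro _ ⟨i, rfl⟩
    by_cases h : i = j
    · subst h; rw [SetLike.mem_coe, shiftRsop_self]; exact Ideal.subset_span ⟨i, rfl⟩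
    · rw [SetLike.mem_coe, shiftRsop_of_ne c j a h]
      exact Ideal.sub_mem _ (Ideal.subset_span ⟨i, rfl⟩)
        (Ideal.mul_mem_left _ _ (Ideal.subset_span ⟨j, rfl⟩))
  · rw [Ideal.span_le]
    rintro _ ⟨i, rfl⟩
    have hj : c j ∈ Ideal.span (Set.range (shiftRsop c j a)) := by
      rw [← shiftRsop_self c j a]; exact Ideal.subset_span ⟨j, rfl⟩
    by_cases h : i = j
    · subst h; exact hj
    · have : c i = shiftRsop c j a i + a ⟨i, h⟩ * c j := by rw [shiftRsop_of_ne c j a h]; ring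
      rw [SetLike.mem_coe, this]
      exact Ideal.add_mem _ (Ideal.subset_span ⟨i, rfl⟩) (Ideal.mul_mem_left _ _ hj)

end Shift

/-! ## Ring level: reading the reduction map `ρ` on generators -/

section Rho

variable {R : Type u} [CommRing R] [IsLocalRing R] {d : ℕ} (c : Fin d → R) (j : Fin d)
  {ρ : chartRing c j →+* MvPolynomial {i : Fin d // i ≠ j} (ResidueField R)}
  (hρF : ∀ F : MvPolynomial (Fin d) R,
    ρ (MvPolynomial.eval₂Hom (chartBase c j) (fun i => chartGen c j i) F) =
      MvPolynomial.map (residue R) (dehomogenize j F))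

include hρF in
/-- `ρ(φ r) = r̄`. [folklore] -/
theorem map_chartBase_of_chartResidueMap (r : R) :
    ρ (chartBase c j r) = MvPolynomial.C (residue R r) := by
  have h := hρF (MvPolynomial.C r)
  rwa [MvPolynomial.eval₂Hom_C, MvPolynomial.algHom_C, MvPolynomial.algebraMap_eq,
    MvPolynomial.map_C] at h

include hρF in
/-- `ρ(e_i) = T_i` for `i ≠ j`. [folklore] -/
theorem map_chartGen_of_chartResidueMap {i : Fin d} (hi : i ≠ j) :
    ρ (chartGen c j i) = MvPolynomial.X ⟨i, hi⟩ := by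
  classical
  have h := hρF (MvPolynomial.X i)
  have hd : dehomogenize j (MvPolynomial.X i : MvPolynomial (Fin d) R) = MvPolynomial.X ⟨i, hi⟩ := by
    change MvPolynomial.aeval (killVar j) (MvPolynomial.X i) = _
    rw [MvPolynomial.aeval_X, killVar_of_ne j hi]
  rwa [MvPolynomial.eval₂Hom_X', hd, MvPolynomial.map_X] at h

include hρF in
/-- `ρ(e_i − φ r) = T_i − r̄`. [folklore] -/
theorem map_chartGen_sub_chartBase_of_chartResidueMap {i : Fin d} (hi : i ≠ j) (r : R) :
    ρ (chartGen c j i - chartBase c j r) = MvPolynomial.X ⟨i, hi⟩ - MvPolynomial.C (residue R r) :=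
  (map_sub ρ _ _).trans (by
    rw [map_chartGen_of_chartResidueMap c j hρF hi, map_chartBase_of_chartResidueMap c j hρF r])

end Rho

/-! ## Linear algebra at the origin of the chart -/

section OriginForms

variable {k : Type*} [Field k] {d : ℕ} (j : Fin d)

/-- The ideal `(T_i : i ≠ j)` of the origin of the chart is maximal. [folklore] -/
theorem isMaximal_span_range_X_origin :
    (Ideal.span (Set.range (MvPolynomial.X : {i : Fin d // i ≠ j} →
      MvPolynomial {i : Fin d // i ≠ j} k))).IsMaximal := by
  have h := isMaximal_span_range_X_sub_C (k := k) (σ := {i : Fin d // i ≠ j}) 0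
  simpa only [Pi.zero_apply, map_zero, sub_zero] using h

/-- **A linear form through the origin of the chart has no `Y_j`-coefficient**: if
`L(T_j := 1) ∈ (T_i : i ≠ j)` then the coefficient of `Y_j` in `L` vanishes. [folklore] -/
theorem apply_single_eq_zero_of_mem_dualVanishingAt_origin {ℓ : Module.Dual k (Fin d → k)}
    (hℓ : ℓ ∈ dualVanishingAt j (Ideal.span (Set.range (MvPolynomial.X : {i : Fin d // i ≠ j} →
      MvPolynomial {i : Fin d // i ≠ j} k)))) :
    ℓ (Pi.single j 1) = 0 := by
  classical
  rw [mem_dualVanishingAt_iff] at hℓ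
  have hker : Ideal.span (Set.range (MvPolynomial.X : {i : Fin d // i ≠ j} →
      MvPolynomial {i : Fin d // i ≠ j} k)) ≤
      RingHom.ker (MvPolynomial.eval (0 : {i : Fin d // i ≠ j} → k)) := by
    rw [Ideal.span_le]
    rintro _ ⟨i, rfl⟩
    rw [SetLike.mem_coe, RingHom.mem_ker, MvPolynomial.eval_X, Pi.zero_apply]
  have h0 := hker hℓ
  rw [RingHom.mem_ker, linearFormPoly, map_sum, map_sum, Finset.sum_eq_single j] at h0
  · rw [map_mul, MvPolynomial.algHom_C, MvPolynomial.algebraMap_eq] at h0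
    change MvPolynomial.eval 0 (MvPolynomial.C (ℓ (Pi.single j 1)) *
      MvPolynomial.aeval (killVar j) (MvPolynomial.X j)) = 0 at h0
    rwa [MvPolynomial.aeval_X, killVar_self, mul_one, MvPolynomial.eval_C] at h0
  · intro i _ hi
    rw [map_mul, MvPolynomial.algHom_C, MvPolynomial.algebraMap_eq]
    change MvPolynomial.eval 0 (MvPolynomial.C (ℓ (Pi.single i 1)) *
      MvPolynomial.aeval (killVar j) (MvPolynomial.X i)) = 0
    rw [MvPolynomial.aeval_X, killVar_of_ne j hi, map_mul, MvPolynomial.eval_X, Pi.zero_apply,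
      mul_zero]
  · exact fun h => (h (Finset.mem_univ _)).elim

/-- A linear form without `Y_j`-coefficient is a polynomial in the `Y_i`, `i ≠ j`. [folklore] -/
theorem linearFormPoly_mem_supported {ℓ : Module.Dual k (Fin d → k)} (hℓ : ℓ (Pi.single j 1) = 0) :
    linearFormPoly k ℓ ∈ MvPolynomial.supported k {i : Fin d | i ≠ j} := by
  rw [linearFormPoly, MvPolynomial.supported_eq_adjoin_X]
  refine Subalgebra.sum_mem _ fun i _ => ?_
  by_cases hi : i = j
  · rw [hi, hℓ, map_zero, zero_mul]; exact Subalgebra.zero_mem _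
  · exact Subalgebra.mul_mem _ (Subalgebra.algebraMap_mem _ _) (Algebra.subset_adjoin ⟨i, hi, rfl⟩)

/-- **Polynomials in linear forms without `Y_j` do not involve `Y_j`.** [folklore] -/
theorem forall_apply_eq_zero_of_subset_linearFormsSubalgebra
    {T : Submodule k (Module.Dual k (Fin d → k))} (hT : ∀ ℓ ∈ T, ℓ (Pi.single j 1) = 0)
    {S : Set (MvPolynomial (Fin d) k)} (hS : S ⊆ linearFormsSubalgebra k T)
    {G : MvPolynomial (Fin d) k} (hG : G ∈ S) {m : Fin d →₀ ℕ} (hm : m ∈ G.support) : m j = 0 := by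
  classical
  by_contra hmj
  have hsupp : linearFormsSubalgebra k T ≤ MvPolynomial.supported k {i : Fin d | i ≠ j} := by
    unfold linearFormsSubalgebra
    rw [Algebra.adjoin_le_iff]
    rintro _ ⟨ℓ, hℓ, rfl⟩
    exact linearFormPoly_mem_supported j (hT ℓ hℓ)
  have hvars := MvPolynomial.mem_supported.mp (hsupp (hS hG))
  have hjv : j ∈ G.vars := (MvPolynomial.mem_vars_iff_mem_support j).mpr ⟨m, hm, Finsupp.mem_support_iff.mpr hmj⟩
  exact (hvars hjv) rfl

end OriginForms

/-! ## `s · φ(c_j) = 0 ⇒ s = 0` on the chart of `c_j` -/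

section Cancel

open Polynomial

/-- **`φ(c_j)` is a non-zero-divisor of the chart ring `B_j`** (Stacks 0804: the image of `a` in
the affine blowup algebra `R[I/a]` is a non-zero-divisor), in the cancellation form used below;
the proof is that of `reesChartBase_mem_nonZeroDivisors` (`AffineBlowup.lean`), repeated here to
keep all instances on `chartRing`. [cite: StacksProject, Tag 0804] -/
theorem eq_zero_of_mul_chartBase_self_eq_zero {R : Type u} [CommRing R] {n : ℕ} (c : Fin n → R)
    (j : Fin n) (s : chartRing c j) (hs0 : s * chartBase c j (c j) = 0) : s = 0 := by
  obtain ⟨k, x, hx, rfl⟩ := HomogeneousLocalization.Away.mk_surjective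
    (reesGrading (Ideal.span (Set.range c)))
    (reesT_mem (c j) (Ideal.mem_span_range_self (f := c) (x := j))) s
  obtain ⟨r, hr⟩ := hx
  have hr' : (x : Polynomial R) = Polynomial.monomial (k • 1) r := hr.symm
  have h0 := congrArg HomogeneousLocalization.val hs0
  rw [HomogeneousLocalization.val_mul, HomogeneousLocalization.val_zero,
    HomogeneousLocalization.Away.val_mk, val_reesChartBase_eq_mk, Localization.mk_mul,
    Localization.mk_eq_mk', IsLocalization.mk'_eq_zero_iff] at h0
  obtain ⟨⟨_, m, rfl⟩, hm⟩ := h0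
  have hzero : c j ^ (m + 1) * r = 0 := by
    have := congrArg (fun p : reesAlgebra (Ideal.span (Set.range c)) =>
      (p : Polynomial R).coeff (m + (k • 1))) hm
    simp only [Subalgebra.coe_mul, Subalgebra.coe_pow, coe_reesT, hr', Subalgebra.coe_algebraMap,
      ← Polynomial.C_eq_algebraMap, Polynomial.monomial_pow, Polynomial.monomial_mul_C,
      Polynomial.monomial_mul_monomial, Polynomial.coeff_monomial, ZeroMemClass.coe_zero,
      Polynomial.coeff_zero, one_mul, if_true] at this
    linear_combination this
  apply HomogeneousLocalization.val_injective
  rw [HomogeneousLocalization.Away.val_mk, HomogeneousLocalization.val_zero, Localization.mk_eq_mk',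
    IsLocalization.mk'_eq_zero_iff]
  refine ⟨⟨_, m + 1, rfl⟩, Subtype.ext ?_⟩
  simp only [Subalgebra.coe_mul, Subalgebra.coe_pow, coe_reesT, hr', Polynomial.monomial_pow,
    Polynomial.monomial_mul_monomial, ZeroMemClass.coe_zero, hzero, map_zero]

end Cancel

/-! ## Scheme level -/

section Scheme

variable {X X' : Scheme.{u}} {π : X' ⟶ X}

set_option maxHeartbeats 400000 in
/-- The image of the exceptional parameter `c_j` in `𝒪_{X′,x′}` is non-zero on the chart of `c_j`
(it is a non-zero-divisor of the chart ring, and `𝒪_{X′,x′}` is a localisation of it). [folklore] -/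
theorem stalkMap_apply_ne_zero_of_chart {x' : X'} {n : ℕ} {c : Fin n → X.presheaf.stalk (π x')}
    (j : Fin n) (𝔴 : PrimeSpectrum (chartRing c j)) (χ : chartRing c j →+* X'.presheaf.stalk x')
    (hχ : ∀ a, χ (chartBase c j a) = (π.stalkMap x').hom a)
    (hloc : @IsLocalization.AtPrime _ _ (X'.presheaf.stalk x') _ χ.toAlgebra 𝔴.asIdeal _) :
    (π.stalkMap x').hom (c j) ≠ 0 := by
  intro h0
  have h0' : χ (chartBase c j (c j)) = 0 := (hχ (c j)).trans h0
  letI := χ.toAlgebra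
  haveI : IsLocalization.AtPrime (X'.presheaf.stalk x') 𝔴.asIdeal := hloc
  obtain ⟨⟨s, hs⟩, hs0⟩ :=
    (IsLocalization.map_eq_zero_iff 𝔴.asIdeal.primeCompl (X'.presheaf.stalk x') (chartBase c j (c j))).mp h0'
  have hs00 : s = 0 := eq_zero_of_mul_chartBase_self_eq_zero c j s hs0
  apply hs
  rw [hs00]
  exact 𝔴.asIdeal.zero_mem

/-- The chart relation `c_i = c_j · e_i` in `𝒪_{X′,x′}`. [folklore] -/
theorem stalkMap_apply_eq_mul_chartGen {x' : X'} {n : ℕ} {c : Fin n → X.presheaf.stalk (π x')}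
    (j : Fin n) (χ : chartRing c j →+* X'.presheaf.stalk x')
    (hχ : ∀ a, χ (chartBase c j a) = (π.stalkMap x').hom a) (i : Fin n) :
    (π.stalkMap x').hom (c i) = (π.stalkMap x').hom (c j) * χ (chartGen c j i) := by
  rw [← hχ, ← hχ, ← map_mul, ← reesChartBase_apply_eq_mul_chartGen c j i]

set_option maxHeartbeats 800000 in
/-- **The near point is the origin of a chart for a suitable regular system of parameters.** In the
situation of `IsBlowup.stalkTau_le_stalkTau_of_isNear_point` (`τ(x) = 2`, `x′` near over the point
centre): for the shifted system `c̃_i = c_i − ã_i c_j` (`ã_i` lifting the coordinates of the rational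
point `x′`, `exists_map_eq_span_of_near_point`) there is a chart presentation
`𝒪_{X′,x′} = (B̃_j)_𝔴̃` of `x′` in which all chart generators `ẽ_i = c̃_i/c̃_j`, `i ≠ j`, lie in `𝔴̃`
([CoP1]: "we choose `(y_1, y_2, y_3)` in such a way that `T_x = <Y_2, Y_3>` … the only point … which
may be near `x` is the point `x′ := (y_1′ = y_1, y_2′ = y_2/y_1, y_3′ = y_3/y_1)`").
[cite: CossartPiltant2008, proof of Lemma 4.3 (3)] -/
theorem IsBlowup.exists_origin_chart_of_isNear_point [IsLocallyNoetherian X] [IsLocallyNoetherian X']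
    {Y : Closeds X} (hπ : IsBlowup π (vanishingIdeal Y)) {J : X.IdealSheafData} {μ : ℕ}
    {x' : X'} [IsRegularLocalRing (X.presheaf.stalk (π x'))] [IsRegularLocalRing (X'.presheaf.stalk x')]
    (hd : (maximalIdeal (X.presheaf.stalk (π x'))).spanFinrank = 3)
    {c : Fin 3 → X.presheaf.stalk (π x')} (hc : Ideal.span (Set.range c) = maximalIdeal _)
    (hcY : Ideal.span (Set.range c) = stalkIdeal (vanishingIdeal Y) (π x'))
    (hτ : stalkTau J (π x') μ = 2) (hnear : IsNear π (vanishingIdeal Y) J μ x') :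
    ∃ (c₂ : Fin 3 → X.presheaf.stalk (π x')) (j : Fin 3) (𝔴 : PrimeSpectrum (chartRing c₂ j))
      (χ : chartRing c₂ j →+* X'.presheaf.stalk x'),
      Ideal.span (Set.range c₂) = maximalIdeal _ ∧
      Ideal.span (Set.range c₂) = stalkIdeal (vanishingIdeal Y) (π x') ∧
      (∀ a, χ (chartBase c₂ j a) = (π.stalkMap x').hom a) ∧
      @IsLocalization.AtPrime _ _ (X'.presheaf.stalk x') _ χ.toAlgebra 𝔴.asIdeal _ ∧
      𝔴.asIdeal.comap (chartBase c₂ j) = maximalIdeal _ ∧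
      ∀ i, i ≠ j → chartGen c₂ j i ∈ 𝔴.asIdeal := by
  classical
  haveI := isDomain_of_isRegularLocalRing (X'.presheaf.stalk x')
  -- (1) a chart presentation w.r.t. `c`; the coordinates `a` of the (rational) near point
  obtain ⟨j, 𝔴, χ, hχ, hloc, h𝔴⟩ := hπ.exists_reesChart_stalk x' c hcY
  have h𝔴' : (maximalIdeal _).map (chartBase c j) ≤ 𝔴.asIdeal := by
    rw [← h𝔴]
    exact Ideal.map_comap_le
  have hnearF : ∀ F : MvPolynomial (Fin 3) (X.presheaf.stalk (π x')), F.IsHomogeneous μ →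
      MvPolynomial.eval c F ∈ stalkIdeal J (π x') →
      (algebraMap (chartRing c j) (Localization.AtPrime 𝔴.asIdeal) :
          chartRing c j →+* Localization.AtPrime 𝔴.asIdeal)
          (MvPolynomial.eval₂Hom (chartBase c j) (fun i => chartGen c j i) F) ∈
        maximalIdeal (Localization.AtPrime 𝔴.asIdeal) ^ μ :=
    fun F hF hFJ => algebraMap_eval₂Hom_mem_pow_of_isNear hcY j 𝔴 χ hχ hloc hnear hF hFJ
  have hτc : hironakaTauAt c (stalkIdeal J (π x')) μ = 2 := by
    rw [← stalkTau_eq J (π x') μ hd c hc]; exact hτ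
  obtain ⟨ρ, -, -, hρF, hcomap, a, -, hq⟩ :=
    exists_map_eq_span_of_near_point hd c hc j 𝔴.asIdeal h𝔴' hnearF hτc
  -- lifts `ã` of the coordinates; `e_i − φ(ã_i) ∈ 𝔴`, hence in `𝔪_{x′}` after `χ`
  obtain ⟨ã, hã⟩ : ∃ ã : {i : Fin 3 // i ≠ j} → X.presheaf.stalk (π x'), ∀ i, residue _ (ã i) = a i :=
    ⟨fun i => Classical.choose (Ideal.Quotient.mk_surjective (a i)),
      fun i => Classical.choose_spec (Ideal.Quotient.mk_surjective (a i))⟩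
  have heW : ∀ i (hi : i ≠ j), chartGen c j i - chartBase c j (ã ⟨i, hi⟩) ∈ 𝔴.asIdeal := by
    intro i hi
    rw [hcomap, Ideal.mem_comap, map_chartGen_sub_chartBase_of_chartResidueMap c j hρF hi, hã, hq]
    exact Ideal.subset_span ⟨⟨i, hi⟩, rfl⟩
  have hmem𝔪 : ∀ i (hi : i ≠ j),
      χ (chartGen c j i - chartBase c j (ã ⟨i, hi⟩)) ∈ maximalIdeal (X'.presheaf.stalk x') :=
    fun i hi => (@IsLocalization.AtPrime.to_map_mem_maximal_iff (chartRing c j) _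
      (X'.presheaf.stalk x') _ χ.toAlgebra 𝔴.asIdeal _ hloc _ inferInstance).mpr (heW i hi)
  -- (2) the shifted system `c̃` and a chart presentation w.r.t. it
  obtain ⟨c₂, hc₂⟩ : ∃ c₂ : Fin 3 → X.presheaf.stalk (π x'), c₂ = shiftRsop c j ã := ⟨_, rfl⟩
  have hc₂span : Ideal.span (Set.range c₂) = maximalIdeal _ := by
    rw [hc₂, span_range_shiftRsop, hc]
  have hc₂Y : Ideal.span (Set.range c₂) = stalkIdeal (vanishingIdeal Y) (π x') := by
    rw [hc₂, span_range_shiftRsop, hcY]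
  obtain ⟨j₂, 𝔴₂, χ₂, hχ₂, hloc₂, h𝔴₂⟩ := hπ.exists_reesChart_stalk x' c₂ hc₂Y
  -- images in `𝒪_{X′,x′}`
  have hσcj : (π.stalkMap x').hom (c j) ≠ 0 := stalkMap_apply_ne_zero_of_chart j 𝔴 χ hχ hloc
  have hu := stalkMap_apply_eq_mul_chartGen j χ hχ
  have hu₂ := stalkMap_apply_eq_mul_chartGen j₂ χ₂ hχ₂
  have hσc₂ : ∀ i (hi : i ≠ j), (π.stalkMap x').hom (c₂ i) =
      (π.stalkMap x').hom (c j) * χ (chartGen c j i - chartBase c j (ã ⟨i, hi⟩)) := by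
    intro i hi
    have h1 : χ (chartGen c j i - chartBase c j (ã ⟨i, hi⟩)) =
        χ (chartGen c j i) - (π.stalkMap x').hom (ã ⟨i, hi⟩) :=
      (map_sub χ _ _).trans (by rw [hχ])
    rw [h1, hc₂, shiftRsop_of_ne c j ã hi, map_sub, map_mul, hu i]
    ring
  have hσc₂j : (π.stalkMap x').hom (c₂ j) = (π.stalkMap x').hom (c j) := by rw [hc₂, shiftRsop_self]
  -- (3) `j₂ = j`: otherwise `c_j = c_j · m · e` with `m ∈ 𝔪_{x′}` forces `c_j = 0` in `𝒪_{x′}`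
  have hj₂ : j₂ = j := by
    by_contra hne
    have h1 : (π.stalkMap x').hom (c j) = (π.stalkMap x').hom (c j) *
        (χ (chartGen c j j₂ - chartBase c j (ã ⟨j₂, hne⟩)) * χ₂ (chartGen c₂ j₂ j)) := by
      have h := hu₂ j
      rw [hσc₂j, hσc₂ j₂ hne, mul_assoc] at h
      exact h
    have hm : χ (chartGen c j j₂ - chartBase c j (ã ⟨j₂, hne⟩)) * χ₂ (chartGen c₂ j₂ j) ∈
        maximalIdeal (X'.presheaf.stalk x') := Ideal.mul_mem_right _ _ (hmem𝔪 j₂ hne)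
    have hunit : IsUnit (1 - χ (chartGen c j j₂ - chartBase c j (ã ⟨j₂, hne⟩)) *
        χ₂ (chartGen c₂ j₂ j)) :=
      IsLocalRing.isUnit_one_sub_self_of_mem_nonunits _ ((IsLocalRing.mem_maximalIdeal _).mp hm)
    have h2 : (π.stalkMap x').hom (c j) *
        (1 - χ (chartGen c j j₂ - chartBase c j (ã ⟨j₂, hne⟩)) * χ₂ (chartGen c₂ j₂ j)) = 0 := by
      rw [mul_sub, mul_one, ← h1, sub_self]
    rcases mul_eq_zero.mp h2 with h | h
    · exact hσcj h
    · exact hunit.ne_zero h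
  subst hj₂
  -- (4) the `ẽ_i`, `i ≠ j`, lie in `𝔴₂`: the point is the origin of the new chart
  have he₂ : ∀ i, i ≠ j₂ → chartGen c₂ j₂ i ∈ 𝔴₂.asIdeal := by
    intro i hi
    rw [← @IsLocalization.AtPrime.to_map_mem_maximal_iff (chartRing c₂ j₂) _ (X'.presheaf.stalk x') _
      χ₂.toAlgebra 𝔴₂.asIdeal _ hloc₂ _ inferInstance]
    change χ₂ (chartGen c₂ j₂ i) ∈ maximalIdeal _
    have h1 : (π.stalkMap x').hom (c j₂) * χ (chartGen c j₂ i - chartBase c j₂ (ã ⟨i, hi⟩)) =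
        (π.stalkMap x').hom (c j₂) * χ₂ (chartGen c₂ j₂ i) := by
      rw [← hσc₂ i hi, ← hσc₂j]
      exact hu₂ i
    rw [← mul_left_cancel₀ hσcj h1]
    exact hmem𝔪 i hi
  exact ⟨c₂, j₂, 𝔴₂, χ₂, hc₂span, hc₂Y, hχ₂, hloc₂, h𝔴₂, he₂⟩

set_option maxHeartbeats 800000 in
/-- **[CoP1] Lemma 4.3 (3): `τ(x′) ≥ τ(x) = 2` at the near point over a point centre.** Let `π` be
the blowing up of the locally Noetherian `X` along a centre `Y` with `𝓘_{Y,x} = 𝔪_x = (c_1, c_2, c_3)`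
at `x = π x′`, `𝒪_{X,x}` regular of dimension `3`, `𝒪_{X′,x′}` regular, `μ ≥ 1`. If `τ(x) = 2` and
`x′` is near (`ord_{x′} J′ = μ`, `J′` the weak transform), then `τ(x) ≤ τ(x′)`.
[cite: CossartPiltant2008, Lemma 4.3 (3), (12)] -/
theorem IsBlowup.stalkTau_le_stalkTau_of_isNear_point [IsLocallyNoetherian X] [IsLocallyNoetherian X']
    {Y : Closeds X} (hπ : IsBlowup π (vanishingIdeal Y)) {J : X.IdealSheafData} {μ : ℕ} (hμ : 1 ≤ μ)
    {x' : X'} [IsRegularLocalRing (X.presheaf.stalk (π x'))] [IsRegularLocalRing (X'.presheaf.stalk x')]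
    (hd : (maximalIdeal (X.presheaf.stalk (π x'))).spanFinrank = 3)
    {c : Fin 3 → X.presheaf.stalk (π x')} (hc : Ideal.span (Set.range c) = maximalIdeal _)
    (hcY : Ideal.span (Set.range c) = stalkIdeal (vanishingIdeal Y) (π x'))
    (hτ : stalkTau J (π x') μ = 2) (hnear : IsNear π (vanishingIdeal Y) J μ x') :
    stalkTau J (π x') μ ≤ stalkTau (controlledTransform π (vanishingIdeal Y) J μ) x' μ := by
  classical
  obtain ⟨c₂, j₂, 𝔴₂, χ₂, hc₂span, hc₂Y, hχ₂, hloc₂, h𝔴₂, he₂⟩ :=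
    hπ.exists_origin_chart_of_isNear_point hd hc hcY hτ hnear
  have hu₂ := stalkMap_apply_eq_mul_chartGen j₂ χ₂ hχ₂
  -- the ring-level data at the origin `𝔴₂` of the chart of `c̃`
  letI := χ₂.toAlgebra
  haveI : IsLocalization.AtPrime (X'.presheaf.stalk x') 𝔴₂.asIdeal := hloc₂
  have halg : ∀ b, (algebraMap (chartRing c₂ j₂) (X'.presheaf.stalk x') :
      chartRing c₂ j₂ →+* X'.presheaf.stalk x') b = χ₂ b := fun b => rfl
  obtain ⟨θ, hθdef⟩ : ∃ θ : ResidueField (X.presheaf.stalk (π x')) →+* ResidueField (X'.presheaf.stalk x'),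
      θ = ResidueField.map (π.stalkMap x').hom := ⟨_, rfl⟩
  have hθ : ∀ r, θ (residue _ r) = residue _ ((algebraMap (chartRing c₂ j₂) (X'.presheaf.stalk x') :
      chartRing c₂ j₂ →+* X'.presheaf.stalk x') (chartBase c₂ j₂ r)) := by
    intro r
    rw [hθdef, ResidueField.map_residue, halg, hχ₂]
  have hJ' : ∀ F : MvPolynomial (Fin 3) (X.presheaf.stalk (π x')), F.IsHomogeneous μ →
      MvPolynomial.eval c₂ F ∈ stalkIdeal J (π x') →
      (algebraMap (chartRing c₂ j₂) (X'.presheaf.stalk x') : chartRing c₂ j₂ →+* X'.presheaf.stalk x')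
        (MvPolynomial.eval₂Hom (chartBase c₂ j₂) (fun i => chartGen c₂ j₂ i) F) ∈
        stalkIdeal (controlledTransform π (vanishingIdeal Y) J μ) x' := by
    intro F hF hFJ
    rw [halg]
    have hff' := reesChartBase_eval_eq_pow_mul_eval₂ c₂ j₂ hF
    have hCmap : (stalkIdeal (vanishingIdeal Y) (π x')).map (π.stalkMap x').hom =
        Ideal.span {χ₂ (chartBase c₂ j₂ (c₂ j₂))} := by
      rw [← hc₂Y, Ideal.map_span_range_eq_span_singleton _ c₂ j₂ _ hu₂, ← hχ₂]
    rw [controlledTransform, stalkIdeal_colon, stalkIdeal_pow, stalkIdeal_comap_eq_map_stalkMap,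
      stalkIdeal_comap_eq_map_stalkMap, hCmap]
    exact map_mem_colon_of_eq_pow_mul (chartBase c₂ j₂) χ₂ (π.stalkMap x').hom hχ₂ hff' hFJ
  have hnear' : stalkIdeal (controlledTransform π (vanishingIdeal Y) J μ) x' ≤
      maximalIdeal (X'.presheaf.stalk x') ^ μ :=
    (le_idealOrder_iff _ x' μ).mp (isNear_iff.mp hnear).ge
  -- all initial forms w.r.t. `c̃` avoid `Y_j` (Hironaka's theorem at the origin)
  have h𝔴₂' : (maximalIdeal _).map (chartBase c₂ j₂) ≤ 𝔴₂.asIdeal := by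
    rw [← h𝔴₂]
    exact Ideal.map_comap_le
  have hnearF₂ : ∀ F : MvPolynomial (Fin 3) (X.presheaf.stalk (π x')), F.IsHomogeneous μ →
      MvPolynomial.eval c₂ F ∈ stalkIdeal J (π x') →
      (algebraMap (chartRing c₂ j₂) (Localization.AtPrime 𝔴₂.asIdeal) :
          chartRing c₂ j₂ →+* Localization.AtPrime 𝔴₂.asIdeal)
          (MvPolynomial.eval₂Hom (chartBase c₂ j₂) (fun i => chartGen c₂ j₂ i) F) ∈
        maximalIdeal (Localization.AtPrime 𝔴₂.asIdeal) ^ μ :=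
    fun F hF hFJ => algebraMap_eval₂Hom_mem_pow_of_isNear hc₂Y j₂ 𝔴₂ χ₂ hχ₂ hloc₂ hnear hF hFJ
  obtain ⟨ρ₂, -, -, hρ₂F, h𝔮₂, -, hS₂⟩ :=
    exists_chartResidueMap_forall_initialForms_near hd c₂ hc₂span j₂ 𝔴₂.asIdeal h𝔴₂' hnearF₂
  haveI := h𝔮₂
  have hq₂ : 𝔴₂.asIdeal.map ρ₂ = Ideal.span (Set.range (MvPolynomial.X : {i : Fin 3 // i ≠ j₂} →
      MvPolynomial {i : Fin 3 // i ≠ j₂} (ResidueField (X.presheaf.stalk (π x'))))) := by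
    refine ((isMaximal_span_range_X_origin (k := ResidueField (X.presheaf.stalk (π x'))) j₂).eq_of_le
      (Ideal.IsPrime.ne_top h𝔮₂) ?_).symm
    rw [Ideal.span_le]
    rintro _ ⟨i, rfl⟩
    rw [SetLike.mem_coe, ← map_chartGen_of_chartResidueMap c₂ j₂ hρ₂F i.2]
    exact Ideal.mem_map_of_mem _ (he₂ i.1 i.2)
  have hdir := directrix_le_dualVanishingAt j₂ (𝔴₂.asIdeal.map ρ₂) hS₂
  rw [hq₂] at hdir
  have hall : ∀ G ∈ initialForms c₂ (stalkIdeal J (π x')) μ, ∀ m ∈ G.support, m j₂ = 0 :=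
    fun G hG m hm => forall_apply_eq_zero_of_subset_linearFormsSubalgebra j₂
      (fun ℓ hℓ => apply_single_eq_zero_of_mem_dualVanishingAt_origin j₂ (hdir hℓ))
      (subset_linearFormsSubalgebra_directrix (ResidueField (X.presheaf.stalk (π x')))
        (initialForms c₂ (stalkIdeal J (π x')) μ :
          Set (MvPolynomial (Fin 3) (ResidueField (X.presheaf.stalk (π x'))))))
      hG hm
  -- apply (12) and rewrite both `τ`'s
  have hle := hironakaTauAt_le_hironakaTauAt_origin hd c₂ hc₂span j₂ 𝔴₂.asIdeal h𝔴₂ he₂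
    (X'.presheaf.stalk x') θ hθ hμ hJ' hnear' hall
  obtain ⟨-, hd', hspan'⟩ := isRegularLocalRing_and_span_originFamily hd c₂ hc₂span j₂ 𝔴₂.asIdeal
    h𝔴₂ he₂ (X'.presheaf.stalk x')
  rw [stalkTau_eq J (π x') μ hd c₂ hc₂span,
    stalkTau_eq _ x' μ hd' (originFamily c₂ j₂ (X'.presheaf.stalk x')) hspan']
  exact hle

end Scheme

end Literature.AlgebraicGeometry.Resolution

end
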